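import Summits.Ventures.QEC.CircuitDistance.PortCleanCycle
import Summits.Ventures.QEC.CircuitDistance.SMSchedule
import HarnessLib

/-!
# Q4 lane, ₛ-spine (1): CYCLE FACTS of a CNOT order and the one-cycle SHAPE of a fault, for any schedule
# (venture QEC, experiment cell CDX, seat qec-cdx-type-2; the `PortCleanCycle.lean` layer of record re-pointed from
# `cycleEvents` to `cycleEventsₛ σ`; nothing here asserts a value of `d_circ`)

WHY. The P3-PORT spine of qec-cdx-type-1 (`PortCleanCycle` … `PortCoverBase`) is generic in the circuit data `S` but hard-wires
print's order through `cycleEvents` in exactly two kinds of facts: (i) the CLEAN-CYCLE LEMMA `evolve_cycleEvents` and (ii) the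
event bookkeeping `mem_cycleEvents_iff` (plus `cycleEvents_retag`, `allEvents_succ`, the tail `… ++ [initZ, idle, idle]`, which
hold for EVERY schedule by construction of `SMSchedule.template`). This file packages (i)+(ii) as a hypothesis structure
`SMSchedule.CycleFacts σ S` so that the downstream ₛ-files are typed ONCE over `(σ, hσ : σ.CycleFacts S)`, proves the
schedule-generic bookkeeping, re-states the one-cycle `shape` layer of `PortCleanCycle.lean` over `cycleEventsₛ σ`
(`shapeₛ`, `shapeₛ_ancZz`, `shapeₛ_ancZx`, `shapeₛ_mX_of_ne`, `shapeₛ_mZ_of_ne`, `shapeₛ_retag` — proofs verbatim, the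
generic lemmas `simulate_tail_Z`, `simulate_slots_of_ne`, `simulate_retag_swap` of the file of record reused by name), and
DISCHARGES the facts for the two orders of the experiment: `sched204_cycleFacts` (from the landed lemmas through the anchor
`cycleEventsₛ_sched204`) and `sched345_cycleFacts` (the clean cycle of order #345 by the same `frameOf` CNOT algebra as
`evolve_cycleEvents_frameOf`, for every `SMCode`). A later generic theorem `templateOK σ ⇒ σ.CycleFacts S` would make all
936 orders instances; it is not needed for the Q4 lane and not attempted here.
-/

namespace Summit.Ventures.QEC.CircuitDistance

open Literature.InformationTheory.QuantumCodes

variable {ℓ m : ℕ}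

/-! ## Schedule-generic event bookkeeping -/

/-- Retagging twice is retagging once. -/
theorem Ev.retag_retag (e : Ev) (a b : ℕ) : (e.retag a).retag b = e.retag b := by cases e <;> rfl

/-- The cycle tag of a retagged event. -/
theorem Ev.cyc_retag (e : Ev) (c : ℕ) : (e.retag c).cyc = c := by cases e <;> rfl

/-- The events of a cycle, retagged, are the events of the new cycle — for every schedule. -/
theorem cycleEventsₛ_retag (σ : SMSchedule) (c c' : ℕ) : (cycleEventsₛ σ c).map (Ev.retag c') = cycleEventsₛ σ c' := by
  simp only [cycleEventsₛ, List.map_map, Function.comp_def, Ev.retag_retag]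

/-- Every event of cycle `c` carries the tag `c` — for every schedule. -/
theorem cyc_of_mem_cycleEventsₛ (σ : SMSchedule) {c : ℕ} {e : Ev} (h : e ∈ cycleEventsₛ σ c) : e.cyc = c := by
  unfold cycleEventsₛ at h
  obtain ⟨e', _, rfl⟩ := List.mem_map.1 h
  exact Ev.cyc_retag e' c

/-- `allEventsₛ` grows by whole cycles. -/
theorem allEventsₛ_succ (σ : SMSchedule) (Nc : ℕ) : allEventsₛ σ (Nc + 1) = allEventsₛ σ Nc ++ cycleEventsₛ σ (Nc + 1) := by
  unfold allEventsₛ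
  rw [List.range_succ, List.flatMap_append]
  simp

/-- The TAIL of every cycle is the template's round 8: `…, MeasX, InitZ, idle q(L), idle q(R)`. -/
theorem cycleEventsₛ_eq_append (σ : SMSchedule) (c : ℕ) :
    cycleEventsₛ σ c = ((σ.roundEvents 1 ++ σ.roundEvents 2 ++ σ.roundEvents 3 ++ σ.roundEvents 4 ++ σ.roundEvents 5 ++
      σ.roundEvents 6 ++ σ.roundEvents 7).map (Ev.retag c) ++ [.measX c]) ++ [.initZ c, .idle c .L8, .idle c .R8] := by
  simp [cycleEventsₛ, SMSchedule.template, Ev.retag]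

variable [NeZero ℓ] [NeZero m]

/-- **CYCLE FACTS** of a CNOT order `σ` for the circuit data `S`: the two order-specific inputs of the P3-PORT spine —
(`mem_iff`) the events of cycle `c` are exactly the events tagged `c` (every layer, idle slot, init and measurement occurs),
and (`clean`) the CLEAN-CYCLE LEMMA: a fault-free cycle run on a state with `z`-clear `Z`-ancillas records
`mZ c ^= ζ ⊕ synZ(data x)`, `mX c ^= synX(data z)`, keeps the data frame and cleans the ancillas (`cleanFrame`, `synX`,
`synZ` of `PortCleanCycle.lean`). Discharged below for `sched204` and `sched345`. -/
structure SMSchedule.CycleFacts (σ : SMSchedule) (S : SMCode ℓ m) : Prop where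
  /-- the events of cycle `c` are exactly the events tagged `c` -/
  mem_iff : ∀ (c : ℕ) (e : Ev), e ∈ cycleEventsₛ σ c ↔ e.cyc = c
  /-- the clean-cycle lemma -/
  clean : ∀ (c : ℕ) (st : State ℓ m), (∀ j, (st.frame (Reg.Z, j)).2 = false) →
    evolve S (cycleEventsₛ σ c) st =
      ⟨cleanFrame S st.frame,
       fun c' i => if c' = c then xor (st.mX c' i) (synX S st.frame.dataZb i) else st.mX c' i,
       fun c' j => if c' = c then xor (st.mZ c' j) (xor (st.frame.ancZx j) (synZ S st.frame.dataXb j)) else st.mZ c' j⟩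

/-- An event belongs to the `Nc`-cycle circuit of `σ` iff its cycle tag is in `1 … Nc`. -/
theorem SMSchedule.CycleFacts.mem_allEventsₛ_iff {σ : SMSchedule} {S : SMCode ℓ m} (hσ : σ.CycleFacts S) (Nc : ℕ) (e : Ev) :
    e ∈ allEventsₛ σ Nc ↔ 1 ≤ e.cyc ∧ e.cyc ≤ Nc := by
  unfold allEventsₛ
  rw [List.mem_flatMap]
  simp only [List.mem_range, hσ.mem_iff]
  constructor
  · rintro ⟨c, hc, he⟩; omega
  · rintro ⟨h1, h2⟩; exact ⟨e.cyc - 1, by omega, by omega⟩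

/-! ## The one-cycle SHAPE of a fault under a schedule -/

/-- The ONE-CYCLE SHAPE of a fault under schedule `σ`: the state after running just its own cycle from the all-clear state
(cf. `shape`). -/
def shapeₛ (σ : SMSchedule) (S : SMCode ℓ m) (f : Fault ℓ m) : State ℓ m := simulate S f (cycleEventsₛ σ f.cyc) State.init

/-- ANCHOR: under print's order the shape is the landed `shape`. -/
theorem shapeₛ_sched204 (S : SMCode ℓ m) (f : Fault ℓ m) : shapeₛ sched204 S f = shape S f := by
  unfold shapeₛ shape; rw [cycleEventsₛ_sched204]

/-- After its own cycle a fault leaves the `Z`-ancillas `z`-clear … -/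
theorem shapeₛ_ancZz (σ : SMSchedule) (S : SMCode ℓ m) (f : Fault ℓ m) (j : BB.Mono ℓ m) :
    ((shapeₛ σ S f).frame (Reg.Z, j)).2 = false := by
  unfold shapeₛ; rw [cycleEventsₛ_eq_append, simulate_append, simulate_tail_Z]

/-- … and `x`-clear except for an `InitZ` fault on that very ancilla (`ζ`). -/
theorem shapeₛ_ancZx (σ : SMSchedule) (S : SMCode ℓ m) (f : Fault ℓ m) (j : BB.Mono ℓ m) :
    (shapeₛ σ S f).frame.ancZx j = decide (f = Fault.initZ f.cyc j) := by
  unfold shapeₛ Frame.ancZx; rw [cycleEventsₛ_eq_append, simulate_append, simulate_tail_Z]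

/-- The shape only writes the outcome slots of its own cycle (`X`-checks). -/
theorem shapeₛ_mX_of_ne (σ : SMSchedule) (S : SMCode ℓ m) (f : Fault ℓ m) {t : ℕ} (ht : t ≠ f.cyc) (i : BB.Mono ℓ m) :
    (shapeₛ σ S f).mX t i = false :=
  ((simulate_slots_of_ne S f f.cyc rfl (cycleEventsₛ σ f.cyc) (fun _ he => cyc_of_mem_cycleEventsₛ σ he) State.init
    (fun _ _ => ⟨fun _ => rfl, fun _ => rfl⟩)) t ht).1 i

/-- The shape only writes the outcome slots of its own cycle (`Z`-checks). -/
theorem shapeₛ_mZ_of_ne (σ : SMSchedule) (S : SMCode ℓ m) (f : Fault ℓ m) {t : ℕ} (ht : t ≠ f.cyc) (j : BB.Mono ℓ m) :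
    (shapeₛ σ S f).mZ t j = false :=
  ((simulate_slots_of_ne S f f.cyc rfl (cycleEventsₛ σ f.cyc) (fun _ he => cyc_of_mem_cycleEventsₛ σ he) State.init
    (fun _ _ => ⟨fun _ => rfl, fun _ => rfl⟩)) t ht).2 j

/-- Retagging a fault to another cycle moves its outcome slots and nothing else (cf. `shape_retag`). -/
theorem shapeₛ_retag (σ : SMSchedule) (S : SMCode ℓ m) (f : Fault ℓ m) (c' : ℕ) :
    shapeₛ σ S (f.retag c') = ⟨(shapeₛ σ S f).frame, fun t i => if t = c' then (shapeₛ σ S f).mX f.cyc i else false,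
      fun t j => if t = c' then (shapeₛ σ S f).mZ f.cyc j else false⟩ := by
  have h := simulate_retag_swap S f c' (cycleEventsₛ σ f.cyc) (fun _ he => cyc_of_mem_cycleEventsₛ σ he) State.init
  rw [cycleEventsₛ_retag] at h
  have hs : shapeₛ σ S (f.retag c') = (shapeₛ σ S f).swapSlots f.cyc c' := by
    unfold shapeₛ; rw [Fault.cyc_retag]; exact h
  rw [hs]
  refine State.ext' rfl ?_ ?_
  · funext t i
    simp only [State.swapSlots, Equiv.swap_apply_def]
    by_cases h1 : t = f.cyc
    · subst h1
      by_cases h2 : f.cyc = c'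
      · simp [h2]
      · simp [h2, shapeₛ_mX_of_ne σ S f (Ne.symm h2)]
    · by_cases h2 : t = c'
      · subst h2; simp only [if_true]
        by_cases h3 : t = f.cyc
        · rw [if_pos h3, h3]
        · rw [if_neg h3]
      · simp [h1, h2, shapeₛ_mX_of_ne σ S f h1]
  · funext t j
    simp only [State.swapSlots, Equiv.swap_apply_def]
    by_cases h1 : t = f.cyc
    · subst h1
      by_cases h2 : f.cyc = c'
      · simp [h2]
      · simp [h2, shapeₛ_mZ_of_ne σ S f (Ne.symm h2)]
    · by_cases h2 : t = c'
      · subst h2; simp only [if_true]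
        by_cases h3 : t = f.cyc
        · rw [if_pos h3, h3]
        · rw [if_neg h3]
      · simp [h1, h2, shapeₛ_mZ_of_ne σ S f h1]

/-! ## The cycle facts of print's order (anchor) -/

/-- Print's order has the cycle facts: the landed `mem_cycleEvents_iff` and `evolve_cycleEvents` through the anchor. -/
theorem sched204_cycleFacts (S : SMCode ℓ m) : sched204.CycleFacts S where
  mem_iff c e := by rw [cycleEventsₛ_sched204]; exact mem_cycleEvents_iff c e
  clean c st h := by rw [cycleEventsₛ_sched204]; exact evolve_cycleEvents S c st h

/-! ## The cycle facts of order #345 -/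

/-- The events of a `sched345` cycle are exactly the events tagged with it. -/
theorem mem_cycleEventsₛ_sched345_iff (c : ℕ) (e : Ev) : e ∈ cycleEventsₛ sched345 c ↔ e.cyc = c := by
  rw [cycleEventsₛ_sched345]
  cases e with
  | initX c' => simp [Ev.cyc, eq_comm]
  | initZ c' => simp [Ev.cyc, eq_comm]
  | measX c' => simp [Ev.cyc, eq_comm]
  | measZ c' => simp [Ev.cyc, eq_comm]
  | cnot c' lay => cases lay <;> simp [Ev.cyc, eq_comm]
  | idle c' s => cases s <;> simp [Ev.cyc, eq_comm]

/-- Re-association of the `X`-syndrome sum from #345's layer order (`A₃, B₁, B₃, B₂, A₁, A₂`) to print's (`synX`). -/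
private theorem xor6_X (A0 A1 A2 B0 B1 B2 : Bool) :
    (((((A2 ^^ B0) ^^ B2) ^^ B1) ^^ A0) ^^ A1) = (((((A1 ^^ B1) ^^ B0) ^^ B2) ^^ A0) ^^ A2) := by decide +revert

/-- Re-association of the `Z`-syndrome sum from #345's layer order (`A₂, A₁, B₂, B₃, B₁, A₃`) to print's (`synZ`). -/
private theorem xor6_Z (X A0 A1 A2 B0 B1 B2 : Bool) :
    ((((((X ^^ A1) ^^ A0) ^^ B1) ^^ B2) ^^ B0) ^^ A2) = (X ^^ ((((((A0 ^^ A2) ^^ B0) ^^ B1) ^^ B2) ^^ A1))) := by decide +revert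

/-- CLEAN-CYCLE LEMMA of order #345, component form: the same end state as print's order (`evolve_cycleEvents_frameOf`) —
the `X`-ancillas accumulate the `X`-syndrome of the data `z`-bits over their six layers and the `Z`-ancillas the
`Z`-syndrome of the data `x`-bits, in #345's layer order, which is immaterial for the sums. Pure CNOT algebra, every `SMCode`. -/
theorem evolve_cycleEventsₛ_sched345_frameOf (S : SMCode ℓ m) (c : ℕ) (xX zX xL zL xR zR xZ : BB.Mono ℓ m → Bool)
    (mX mZ : ℕ → BB.Mono ℓ m → Bool) :
    evolve S (cycleEventsₛ sched345 c) ⟨frameOf xX zX xL zL xR zR xZ (fun _ => false), mX, mZ⟩ =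
      ⟨frameOf (fun _ => false) (synX S (frameOf xX zX xL zL xR zR xZ (fun _ => false)).dataZb) xL zL xR zR
          (fun _ => false) (fun _ => false),
       fun c' i => if c' = c then xor (mX c' i) (synX S (frameOf xX zX xL zL xR zR xZ (fun _ => false)).dataZb i) else mX c' i,
       fun c' j => if c' = c then xor (mZ c' j) (xor (xZ j) (synZ S (frameOf xX zX xL zL xR zR xZ (fun _ => false)).dataXb j))
         else mZ c' j⟩ := by
  rw [cycleEventsₛ_sched345]
  simp only [evolve_cons, evolve_nil, applyEv, Layer.ctrl, Layer.tgt, Layer.mon,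
    clearReg_frameOf_X, clearReg_frameOf_Z, cnotLayer_frameOf_XL, cnotLayer_frameOf_XR, cnotLayer_frameOf_LZ,
    cnotLayer_frameOf_RZ, Bool.false_xor, Bool.xor_false]
  refine State.ext' ?_ ?_ ?_
  · funext q; rcases q with ⟨r, i⟩
    cases r <;> simp only [frameOf, synX, Frame.dataZb, Sum.elim_inl, Sum.elim_inr]
    conv_lhs => rw [xor6_X]
  · funext c' i
    simp only [frameOf, synX, Frame.dataZb, Sum.elim_inl, Sum.elim_inr]
    conv_lhs => rw [xor6_X]
  · funext c' j
    simp only [frameOf, synZ, Frame.dataXb, Sum.elim_inl, Sum.elim_inr]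
    conv_lhs => rw [xor6_Z]

/-- CLEAN-CYCLE LEMMA of order #345 (cf. `evolve_cycleEvents`). -/
theorem evolve_cycleEventsₛ_sched345 (S : SMCode ℓ m) (c : ℕ) (st : State ℓ m)
    (hZz : ∀ j, (st.frame (Reg.Z, j)).2 = false) :
    evolve S (cycleEventsₛ sched345 c) st =
      ⟨cleanFrame S st.frame,
       fun c' i => if c' = c then xor (st.mX c' i) (synX S st.frame.dataZb i) else st.mX c' i,
       fun c' j => if c' = c then xor (st.mZ c' j) (xor (st.frame.ancZx j) (synZ S st.frame.dataXb j)) else st.mZ c' j⟩ := by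
  obtain ⟨F, mX, mZ⟩ := st
  have hF : F = frameOf (fun i => (F (.X, i)).1) (fun i => (F (.X, i)).2) (fun i => (F (.L, i)).1) (fun i => (F (.L, i)).2)
      (fun i => (F (.R, i)).1) (fun i => (F (.R, i)).2) (fun i => (F (.Z, i)).1) (fun _ => false) := by
    conv_lhs => rw [← frameOf_eta F]
    congr 1
    funext j; exact hZz j
  have hdZ : (frameOf (fun i => (F (.X, i)).1) (fun i => (F (.X, i)).2) (fun i => (F (.L, i)).1) (fun i => (F (.L, i)).2)
      (fun i => (F (.R, i)).1) (fun i => (F (.R, i)).2) (fun i => (F (.Z, i)).1) (fun _ => false)).dataZb = F.dataZb := by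
    funext q; rcases q with i | i <;> rfl
  have hdX : (frameOf (fun i => (F (.X, i)).1) (fun i => (F (.X, i)).2) (fun i => (F (.L, i)).1) (fun i => (F (.L, i)).2)
      (fun i => (F (.R, i)).1) (fun i => (F (.R, i)).2) (fun i => (F (.Z, i)).1) (fun _ => false)).dataXb = F.dataXb := by
    funext q; rcases q with i | i <;> rfl
  conv_lhs => rw [hF]
  rw [evolve_cycleEventsₛ_sched345_frameOf, hdZ, hdX]
  refine State.ext' ?_ rfl rfl
  funext q; rcases q with ⟨r, i⟩
  cases r <;> simp [frameOf, cleanFrame]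

/-- Order #345 has the cycle facts, for every circuit data `S`. -/
theorem sched345_cycleFacts (S : SMCode ℓ m) : sched345.CycleFacts S where
  mem_iff := mem_cycleEventsₛ_sched345_iff
  clean := evolve_cycleEventsₛ_sched345 S

end Summit.Ventures.QEC.CircuitDistance
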